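import Summits.AtomisticToContinuum.HydrodynamicLimit.Theorems.AntiMazurCoboundariesCorrectorPressureDecayKiferCellTranslation
import Mathlib.Probability.ConditionalProbability

/-! Scratch: wave-4 signatures (collar trick (B5)) + the shared definition `c9CellCore`; local copies of the W2-2-owned defs. -/

noncomputable section

open MeasureTheory ProbabilityTheory Set Filter Topology InformationTheory
open scoped ENNReal NNReal

namespace Summit.AtomisticToContinuum.HydrodynamicLimit.Theorems.KiferCompactification

open Literature.MathematicalPhysics.KineticTheory (T3 V3 hsDiameter localGibbsLaw blowUpPoint blowUp)
open Literature.MathematicalPhysics.KineticTheory.HardSphereDLR (gibbsSpecMeasure)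
open Literature.MathematicalPhysics.KineticTheory.PointProcess (windowLaw windowRestrict centredBox density)
open Literature.Analysis.FluidPDE (HardSphereFlow Config IsHardCore IsHardSphereGibbs IsTranslationInvariant)
open Literature.Analysis.FunctionSpaces (PointConfig)

/-- (W2-2-owned; local copy) -/
def c9PerSqDist (S : ℝ) (y y' : V3) : ℝ :=
  ∑ i, (min |y i - y' i| (S - |y i - y' i|)) ^ 2

/-- (W2-2-owned; local copy) -/
def c9TorusHardCoreTuples (S : ℝ) (m n : ℕ) : Set ((Fin 3 → Fin m) → PointConfig (V3 × V3)) :=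
  {t | (∑ j, (t j).count univ) = n ∧
    ∀ j j' (p q : V3 × V3), p ∈ t j → q ∈ t j' → (j ≠ j' ∨ p ≠ q) → 1 ≤ c9PerSqDist S p.1 q.1}

/-- The CORE of the cell `j`: the closed box of the points of the cell at (coordinatewise) distance `≥ 1` from its faces,
`{y | ∀ i, y i ∈ [-S/2 + jᵢ S/m + 1, -S/2 + (jᵢ+1) S/m - 1]}` (empty when `S/m < 2`). Points of the core are at periodic distance `≥ 1` from
every point outside the cell. -/
def c9CellCore (S : ℝ) (m : ℕ) (j : Fin 3 → Fin m) : Set V3 :=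
  {y | ∀ i, y i ∈ Icc (-S / 2 + ((j i : ℕ) : ℝ) * (S / m) + 1) (-S / 2 + (((j i : ℕ) : ℝ) + 1) * (S / m) - 1)}

/-- W4-1 (B5, the collar trick): the product of the free cell measures charges the torus-hard-core tuples with prescribed total number at
least as much as the product over cells of (void collar) × (exact count in the core). -/
theorem c9_pi_free_torusHardCoreTuples_ge {z β : ℝ} {u : V3} (hz : 0 ≤ z) (hβ : 0 < β) {S : ℝ} (hS : 0 < S) {m : ℕ} (hm : 2 ≤ m)
    (n : ℕ) (k : (Fin 3 → Fin m) → ℕ) (hk : ∑ j, k j = n) :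
    ∏ j, ENNReal.ofReal (Real.exp (-(z * (volume (c9Cell S m j \ c9CellCore S m j)).toReal))) *
        gibbsSpecMeasure 1 z β u (c9CellCore S m j) ∅ {ω | ω.count univ = k j} ≤
      (Measure.pi fun j : Fin 3 → Fin m => gibbsSpecMeasure 1 z β u (c9Cell S m j) ∅) (c9TorusHardCoreTuples S m n) := by
  sorry

end Summit.AtomisticToContinuum.HydrodynamicLimit.Theorems.KiferCompactification

end
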